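import HarnessLib
import Summits.QuantumFields.YangMills.Theses.BalabanUVNodes

/-!
# BC3 line for crux `UV` (stmt-QuantumFields-19351) of route-QuantumFields-BalabanLadder — skeleton rev 12 CANDIDATE (KNIT 1, sextuple-prime, after Track A rev 20)

Candidate bytes by ★ym-osasm-p1 g9 for the OWNER ★ym-beyond-p2 (only the owner ∕ the unit naming the crux may `skeleton check --crux` ∕ `crux write`),
2026-08-27.  Trigger: route-QuantumFields-BalabanUVNodes (Track A) rev 20 080326730141 (plan g67∕g68; director-ym ★★★ LINE №160∕№162∕№166∕№168: FINDING №7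
«TLaw₁₃ at step 0» ⇒ ONE re-key on the v1.5 record `Node00/Record13SepCoP.lean`; OS-assembly census rev 20 (pending)): the four ⁗ Stage-13 items K0⁗–K3⁗
(`Record13SepInhabited` ∕ `StabilityBAtRecordR13Sep` ∕ `EndpointGivenBR13Sep` ∕ `SpineGivenEndpointR13Sep`, 20289 ∕ 20290 ∕ 20291 ∕ 20292) are retriaged ASIDE and four
NEW items K0⁵–K3⁵ over the proviso `Stage13Params.Provisos₁₃SepCoP` ∕ `Node00.datumOfRecord₁₃SepCoP` are live: `Record13SepCoPInhabited` 20293 ∕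
`StabilityBAtRecordR13SepCoP` 20294 ∕ `EndpointGivenBR13SepCoP` 20295 ∕ `SpineGivenEndpointR13SepCoP` 20296; Track A's deciding theorem is now
`closes (h0 : Record13SepCoPInhabited) (h1 : StabilityBAtRecordR13SepCoP) (h2 : EndpointGivenBR13SepCoP) (h3 : SpineGivenEndpointR13SepCoP) : BalabanLadder.UV`
(conclusion = the spine's `UV` BY NAME, today's Stage-0 text).  Rev 12 = the registered rev 11 (67a07bec6ce9a7d1, 2026-08-27T06:07:07Z) re-keyed to
the ⁵ four — four token edits, composition unchanged: four stubs = Track A's four load-bearing items K0⁵–K3⁵ BY NAME, composition =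
`BalabanUVNodes.closes` BY NAME, conclusion = `Summit.QuantumFields.YangMills.Theses.BalabanLadder.UV` BY NAME.
(Registry history: rev 6 over the ₁₁ four died at Track A rev 13, rev 8∕9 over the ₁₂ four at rev 16, rev 10 over the ‴ four at rev 18, rev 11 over
the ⁗ four at rev 20 — each time the minute `closes` changes binders; the spine route file rev 9 b1980dd58741 needs NO edit, the constant `UV` is untouched.)
Owner RULING R27 stands: the spine's `UV` TEXT stays Stage-0 at R85 (no `--restate UV`), so this skeleton is independent of the R85 batch hour.
By-name station for consumers one line before the projection: `Theorems/BalabanLadderUVRecord13SepCoP{Defs,,Tether}.lean` (★osasm-p1 g9,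
`Cruxes.UV.Record13SepCoP.uv_of_record13SepCoPChain_two = @BalabanUVNodes.closes` by `rfl`).
Bookkeeping only (`UV` is discharged through Track A, never staffed head-on on the spine — director R85 hold); NOT ℝ⁴, NOT OS,
NOT a gap, NOT Clay.
-/

namespace Summit.QuantumFields.YangMills.Cruxes.UV.BirthRev12

open Summit.QuantumFields.YangMills.Theses

/-- stub K0⁵ = Track A item `Record13SepCoPInhabited` (stmt-QuantumFields-20293) by name: on every four-torus family the Stage-13
parameter tuple of record is inhabited with the v1.5 provisos `Provisos₁₃SepCoP` and the bundle `ZtUnity ∧ SlotsNondegenerate₁₃`, `Admissible`. -/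
theorem stub_K0 : BalabanUVNodes.Record13SepCoPInhabited := by
  sorry

/-- stub K1⁵ = Track A item `StabilityBAtRecordR13SepCoP` (stmt-QuantumFields-20294) by name: given inhabitation, (B) as printed +
the non-vacuity window at some v1.5 Stage-13 datum of record `datumOfRecord₁₃SepCoP`. -/
theorem stub_K1 : BalabanUVNodes.StabilityBAtRecordR13SepCoP := by
  sorry

/-- stub K2⁵ = Track A item `EndpointGivenBR13SepCoP` (stmt-QuantumFields-20295) by name: endpoint existence given (B) + window, at
every v1.5 Stage-13 datum of record. -/
theorem stub_K2 : BalabanUVNodes.EndpointGivenBR13SepCoP := by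
  sorry

/-- stub K3⁵ = Track A item `SpineGivenEndpointR13SepCoP` (stmt-QuantumFields-20296) by name: the hybrid-NE7 spine given (B) + END, at
every v1.5 Stage-13 datum of record. -/
theorem stub_K3 : BalabanUVNodes.SpineGivenEndpointR13SepCoP := by
  sorry

/-- Composition (closed form): the spine crux `UV` BY NAME through Track A's rev-20 deciding theorem BY NAME. -/
theorem UV_of : BalabanLadder.UV :=
  BalabanUVNodes.closes stub_K0 stub_K1 stub_K2 stub_K3

end Summit.QuantumFields.YangMills.Cruxes.UV.BirthRev12
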